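import Summits.CriticalPhenomena.PercolationContinuityZ3.Theorems.PercNearOneGluingNoHeavyLowerTailSahiSlotTensorConeDim
import Summits.CriticalPhenomena.PercolationContinuityZ3.Theorems.PercNearOneGluingNoHeavyLowerTailSahiSlotPairCert

/-!
# The "all but two pinned" certificate format is antitone in the dimension

Support file of the one-cut programme (crux `NoHeavyLowerTail`, stmt-CriticalPhenomena-4575; cell `prim-masterthm`, seat P3, gen 21; HIERARCHY §29).
`SahiSlot.PairLitCert d n` (…SahiSlotPairCert): at order `n + 2`, for every `n`-tuple of up-sets (pinned) a nonnegative combination of PAIRS of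
literals of the last two members.  THIS FILE: **`PairLitCert.of_succ : PairLitCert (d+1) n → PairLitCert d n`** — pin the CYLINDERS over the
given up-sets, restrict the certificate to cylinder families (`Lit.eval_comp_tail`: literals of `[n+2]^{d+1}` read on cylinders are literals of
`[n+2]^d` or `0`) and divide by `(n+2)!` (`patternForm_comp_tail`).  So a pivotal-pair certificate in dimension `d+1` yields one in dimension `d`,
exactly as for the obligation `SlotPatternPos` and the global format `LitProdCert`. Pure, standard axioms. [this work]
-/

namespace Summit.CriticalPhenomena.PercolationContinuityZ3.Theorems

open Finset Function Equiv
open Literature.Combinatorics.Sahi2008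

namespace SahiSlot

section PairDim

variable {d n : ℕ}

/-- The `pairFam` of cylinders is the cylinder of the `pairFam`. [this work] -/
theorem pairFam_comp_tail (A : Fin n → Q d (n + 2) → ℝ) (B C : Q d (n + 2) → ℝ) :
    pairFam (fun i => A i ∘ Fin.tail) (B ∘ Fin.tail) (C ∘ Fin.tail) = fun i => pairFam A B C i ∘ Fin.tail := by
  funext i
  unfold pairFam
  refine Fin.lastCases ?_ (fun j => ?_) i
  · simp only [Fin.snoc_last]
  · simp only [Fin.snoc_castSucc]
    refine Fin.lastCases ?_ (fun j' => ?_) j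
    · simp only [Fin.snoc_last]
    · simp only [Fin.snoc_castSucc]

/-- **The pair format is antitone in the dimension**: `PairLitCert (d+1) n → PairLitCert d n`. [this work] -/
theorem PairLitCert.of_succ (h : PairLitCert (d + 1) n) : PairLitCert d n := by
  intro A hA
  obtain ⟨k, coef, J, J', hcoef, hid⟩ := h (fun i => cylSet (A i)) fun i => isUpperSet_cylSet (hA i)
  set c : ℝ := (Fintype.card (Perm (Fin (n + 2))) : ℝ) with hc
  have hcpos : 0 < c := by rw [hc]; exact_mod_cast Fintype.card_pos
  refine ⟨k, fun j => coef j / c * ((if (J j).tailOK then (1 : ℝ) else 0) * (if (J' j).tailOK then (1 : ℝ) else 0)),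
    fun j => (J j).tailLit, fun j => (J' j).tailLit, ?_, ?_⟩
  · intro j
    refine mul_nonneg (div_nonneg (hcoef j) hcpos.le) (mul_nonneg ?_ ?_) <;> split_ifs <;> norm_num
  · intro B C hB hC
    have h1 := hid (cylSet B) (cylSet C) (isUpperSet_cylSet hB) (isUpperSet_cylSet hC)
    simp_rw [setInd_cylSet] at h1
    rw [pairFam_comp_tail, patternForm_comp_tail] at h1
    simp_rw [Lit.eval_comp_tail] at h1
    rw [← hc] at h1
    have key : ∀ j : Fin k, ((if (J j).tailOK then (J j).tailLit.eval (setInd B) else 0) *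
        (if (J' j).tailOK then (J' j).tailLit.eval (setInd C) else 0)) =
        ((if (J j).tailOK then (1 : ℝ) else 0) * (if (J' j).tailOK then (1 : ℝ) else 0)) *
          ((J j).tailLit.eval (setInd B) * (J' j).tailLit.eval (setInd C)) := by
      intro j
      split_ifs <;> simp
    simp_rw [key] at h1
    apply mul_left_cancel₀ hcpos.ne'
    rw [h1, mul_sum]
    refine sum_congr rfl fun j _ => ?_
    field_simp

/-- `PairLitCert d' n → PairLitCert d n` for `d ≤ d'`. [this work] -/
theorem PairLitCert.of_le {d d' : ℕ} (hdd' : d ≤ d') (h : PairLitCert d' n) : PairLitCert d n := by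
  obtain ⟨k, rfl⟩ := Nat.exists_eq_add_of_le hdd'
  induction k with
  | zero => simpa using h
  | succ k ih => exact ih (Nat.le_add_right d k) (PairLitCert.of_succ (by rw [← Nat.add_assoc] at h; exact h))

end PairDim

end SahiSlot

end Summit.CriticalPhenomena.PercolationContinuityZ3.Theorems
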